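import Mathlib
import HarnessLib
import Summits.ValiantsHypothesis.ValiantsHypothesis.Theorems.EquivariantDialLayersSuperlinear

/-!
# Non-emptiness of the window-stable ideal width of `per_m` (the monomial cut), the hne-free floors,
and the junk value above degree `m`

Support file for route R24613 (`EquivariantDial`), cell `A = EqHardBiPerm`
(`stmt-ValiantsHypothesis-23702`), leaf `R^lay = EquivariantDialLayers.IdealWidthSuperpoly biPermSubst`
(`∀ c, ∃ m d, d ≤ m ∧ m ^ c + c < idealWidth (biPermSubst m) per_m d`). It closes NO item.

* (α) `hasIdealWidthLE_monomials`: for `d ≤ m` the `(m²)^d` monomials of degree `d` are a window-stable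
  degree-`d` cut of `per_m` — so the width set `{r | HasIdealWidthLE (biPermSubst m) per_m d r}` is
  NON-EMPTY, `idealWidth` is an attained infimum and `idealWidth (biPermSubst m) per_m d ≤ (m²)^d`.
* (β) the hypothesis `hne : ∃ r, HasIdealWidthLE …` of the landed floors is discharged BY NAME:
  `(m / gcd (m, d))² ≤ idealWidth` (Characters), `m² ≤ idealWidth` for `0 < d < m`, `m ≥ 5` (Square),
  `(pq - 1) · pq (pq - 3) / 2 ≤ idealWidth (biPermSubst (pq)) per_{pq} 2` for `p, q ≥ 3` (Superlinear) and
  `216 ≤ idealWidth (biPermSubst 9) per_9 2` now hold unconditionally.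
* (γ) for `d > m` NO degree-`d` homogeneous cut contains `per_m` (every monomial of an element of the ideal
  of degree-`d` forms has degree `≥ d`, while `per_m ≠ 0` is a form of degree `m`), so there the width is
  the junk value `sInf ∅ = 0`: this is exactly why the leaf carries the guard `d ≤ m`.

Honest scope: bookkeeping around the landed rungs — it removes a hypothesis and records the trivial
ceiling `(m²)^d`; it proves nothing super-polynomial and touches neither `EqHardBiPerm` nor
`IdealWidthSuperpoly` nor VP ≠ VNP. The monomial cut is the `d`-th power of the irrelevant ideal
(folklore; [cite: MillerSturmfels2005, §1.1]; [cite: CoxLittleOShea2007, Ch. 8 §3]).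
-/

set_option linter.dupNamespace false

namespace Summit.ValiantsHypothesis.ValiantsHypothesis.Theorems.EquivariantDialLayersNonempty

open MvPolynomial Matrix Literature.Computability.AlgebraicComplexity
open Summit.ValiantsHypothesis.ValiantsHypothesis.Theorems.EquivariantDialNode
open Summit.ValiantsHypothesis.ValiantsHypothesis.Theorems.EquivariantDialLayers
open Summit.ValiantsHypothesis.ValiantsHypothesis.Theorems.EquivariantDialLayersCharacters
open Summit.ValiantsHypothesis.ValiantsHypothesis.Theorems.EquivariantDialLayersSpecht
open Summit.ValiantsHypothesis.ValiantsHypothesis.Theorems.EquivariantDialLayersSquare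
open Summit.ValiantsHypothesis.ValiantsHypothesis.Theorems.EquivariantDialLayersSuperlinear
open Equiv (Perm)

variable {m d : ℕ}

/-! ## (α) The degree-`d` monomial cut -/

/-- `per_m = ∑_σ ∏_i x_{σ i, i}`. -/
theorem perPoly_fin_eq_sum (m : ℕ) :
    perPoly (Fin m) ℂ = ∑ σ : Perm (Fin m), ∏ i : Fin m, X (σ i, i) := by
  simp only [perPoly, Matrix.permanent, Matrix.mvPolynomialX_apply]

/-- A product of `d` variables is homogeneous of degree `d`. -/
theorem isHomogeneous_prod_X (f : Fin d → Fin m × Fin m) :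
    (∏ i, X (f i) : MvPolynomial (Fin m × Fin m) ℂ).IsHomogeneous d := by
  have h := IsHomogeneous.prod (Finset.univ : Finset (Fin d))
    (fun i => (X (f i) : MvPolynomial (Fin m × Fin m) ℂ)) (fun _ => 1) fun i _ => isHomogeneous_X ℂ (f i)
  simpa using h

/-- Every diagonal term `∏_i x_{σ i, i}` of `per_m` is a multiple of a degree-`d` monomial (`d ≤ m`):
split the product over the first `d` rows and the rest. -/
theorem prod_X_mem_idealSpan (hd : d ≤ m) (σ : Perm (Fin m)) :
    (∏ i : Fin m, X (σ i, i) : MvPolynomial (Fin m × Fin m) ℂ) ∈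
      Ideal.span ((Finset.univ.image fun f : Fin d → Fin m × Fin m =>
        (∏ i, X (f i) : MvPolynomial (Fin m × Fin m) ℂ)) : Set (MvPolynomial (Fin m × Fin m) ℂ)) := by
  classical
  rw [← Finset.prod_mul_prod_compl (Finset.univ.map (Fin.castLEEmb hd))
    (fun i : Fin m => (X (σ i, i) : MvPolynomial (Fin m × Fin m) ℂ))]
  refine Ideal.mul_mem_right _ _ (Ideal.subset_span (Finset.mem_coe.mpr (Finset.mem_image.mpr
    ⟨fun j => (σ (Fin.castLE hd j), Fin.castLE hd j), Finset.mem_univ _, ?_⟩)))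
  rw [Finset.prod_map]
  rfl

/-- ★ NON-EMPTINESS OF THE WIDTH: for `d ≤ m` the `(m²)^d` monomials of degree `d` are a window-stable
degree-`d` cut of `per_m` (the `d`-th power of the irrelevant ideal contains every form of degree `≥ d`). -/
theorem hasIdealWidthLE_monomials (hd : d ≤ m) :
    HasIdealWidthLE (biPermSubst m) (perPoly (Fin m) ℂ) d ((m * m) ^ d) := by
  classical
  refine ⟨Finset.univ.image fun f : Fin d → Fin m × Fin m =>
    (∏ i, X (f i) : MvPolynomial (Fin m × Fin m) ℂ), ?_, ?_, ?_, ?_⟩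
  · exact Finset.card_image_le.trans_eq (by simp)
  · intro p hp
    obtain ⟨f, -, rfl⟩ := Finset.mem_image.mp hp
    exact isHomogeneous_prod_X f
  · intro γ hγ p hp
    obtain ⟨f, -, rfl⟩ := Finset.mem_image.mp hp
    obtain ⟨σ, τ, hγe⟩ := exists_prodCongr_of_mem_biPermSubst hγ
    rw [hγe, linSubst_permMatrix, map_prod]
    simp only [rename_X]
    exact Submodule.subset_span (Finset.mem_coe.mpr (Finset.mem_image.mpr
      ⟨fun i => (Equiv.prodCongr σ τ).symm (f i), Finset.mem_univ _, rfl⟩))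
  · rw [perPoly_fin_eq_sum]
    exact Ideal.sum_mem _ fun σ _ => prod_X_mem_idealSpan hd σ

/-- The trivial ceiling: `idealWidth (biPermSubst m) per_m d ≤ (m²)^d` for `d ≤ m`. -/
theorem idealWidth_le_pow (hd : d ≤ m) : idealWidth (biPermSubst m) (perPoly (Fin m) ℂ) d ≤ (m * m) ^ d :=
  idealWidth_le (hasIdealWidthLE_monomials hd)

/-- The width set is non-empty for `d ≤ m` (the hypothesis `hne` of the landed floors). -/
theorem exists_hasIdealWidthLE (hd : d ≤ m) : ∃ r, HasIdealWidthLE (biPermSubst m) (perPoly (Fin m) ℂ) d r :=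
  ⟨_, hasIdealWidthLE_monomials hd⟩

/-! ## (β) The hne-free floors and the unconditional rung -/

/-- `(m / gcd (m, d))² ≤ idealWidth (biPermSubst m) per_m d` for `0 < m`, `d ≤ m` (Characters, hne-free). -/
theorem sq_div_gcd_le_idealWidth' (hm : 0 < m) (hd : d ≤ m) :
    (m / Nat.gcd m d) ^ 2 ≤ idealWidth (biPermSubst m) (perPoly (Fin m) ℂ) d :=
  sq_div_gcd_le_idealWidth hm (exists_hasIdealWidthLE hd)

/-- `m² ≤ idealWidth (biPermSubst m) per_m d` for `m ≥ 5`, `0 < d < m` (Square, hne-free). -/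
theorem sq_le_idealWidth' (hm : 5 ≤ m) (hd : 0 < d) (hdm : d < m) :
    m ^ 2 ≤ idealWidth (biPermSubst m) (perPoly (Fin m) ℂ) d :=
  sq_le_idealWidth hm hd hdm (exists_hasIdealWidthLE hdm.le)

/-- `(pq - 1) · (pq (pq - 3) / 2) ≤ idealWidth (biPermSubst (pq)) per_{pq} 2` for `p, q ≥ 3` (Superlinear,
hne-free). -/
theorem mul_le_idealWidth_two' {p q : ℕ} (hp : 3 ≤ p) (hq : 3 ≤ q) :
    (p * q - 1) * (p * q * (p * q - 3) / 2) ≤ idealWidth (biPermSubst (p * q)) (perPoly (Fin (p * q)) ℂ) 2 :=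
  mul_le_idealWidth_two hp hq
    (exists_hasIdealWidthLE ((Nat.mul_le_mul hp hq).trans' (by norm_num)))

/-- ★ `216 ≤ idealWidth (biPermSubst 9) per_9 2`, unconditionally: the lineage's first bound above the
evaluation ceiling `m² = 81`, free of the non-emptiness hypothesis. It is a cubic bound at the single degree
`d = 2`; it says nothing super-polynomial and touches neither `EqHardBiPerm` nor `IdealWidthSuperpoly`. -/
theorem idealWidth_two_nine : 216 ≤ idealWidth (biPermSubst 9) (perPoly (Fin 9) ℂ) 2 :=
  le_idealWidth_two_nine (exists_hasIdealWidthLE (by norm_num))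

/-! ## (γ) Above the degree of `per_m` the width is the junk value `0` -/

/-- Every monomial of an element of the ideal generated by forms of degree `d` has degree `≥ d`. -/
theorem le_weight_of_mem_idealSpan {s : Set (MvPolynomial (Fin m × Fin m) ℂ)}
    (hs : ∀ q ∈ s, q.IsHomogeneous d) {p : MvPolynomial (Fin m × Fin m) ℂ} (hp : p ∈ Ideal.span s) :
    ∀ x ∈ p.support, d ≤ Finsupp.weight (1 : Fin m × Fin m → ℕ) x := by
  classical
  induction hp using Submodule.span_induction with
  | mem q hq => exact fun x hx => (hs q hq (mem_support_iff.mp hx)).symm.le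
  | zero => simp
  | add p q _ _ ihp ihq =>
      intro x hx
      rcases Finset.mem_union.mp (Finsupp.support_add hx) with h | h
      exacts [ihp x h, ihq x h]
  | smul a q _ ih =>
      intro x hx
      rw [smul_eq_mul] at hx
      obtain ⟨y, -, z, hz, rfl⟩ := Finset.mem_add.mp (support_mul a q hx)
      rw [map_add]
      exact (ih z hz).trans (Nat.le_add_left _ _)

/-- For `m < d` NO degree-`d` homogeneous cut contains `per_m`. -/
theorem not_hasIdealWidthLE_of_lt (hd : m < d) (r : ℕ) :
    ¬ HasIdealWidthLE (biPermSubst m) (perPoly (Fin m) ℂ) d r := by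
  rintro ⟨s, -, hs, -, hmem⟩
  obtain ⟨x, hx⟩ := MvPolynomial.ne_zero_iff.mp (perPoly_ne_zero (Fin m) ℂ)
  have h1 := le_weight_of_mem_idealSpan hs hmem x (mem_support_iff.mpr hx)
  have h2 : Finsupp.weight (1 : Fin m × Fin m → ℕ) x = m := by
    simpa using (perPoly_isHomogeneous (n := Fin m) (k := ℂ)) hx
  omega

/-- For `m < d` the width set is empty and `idealWidth (biPermSubst m) per_m d = sInf ∅ = 0` — the junk
value the leaf's guard `d ≤ m` excludes. -/
theorem idealWidth_eq_zero_of_lt (hd : m < d) : idealWidth (biPermSubst m) (perPoly (Fin m) ℂ) d = 0 := by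
  unfold idealWidth
  have : {r | HasIdealWidthLE (biPermSubst m) (perPoly (Fin m) ℂ) d r} = ∅ := by
    ext r
    simp only [Set.mem_setOf_eq, Set.mem_empty_iff_false, iff_false]
    exact not_hasIdealWidthLE_of_lt hd r
  rw [this, Nat.sInf_empty]

/-- Summary of the degree profile: `1 ≤ idealWidth ≤ (m²)^d` is attained for `d ≤ m` (with the landed
floors in between), and `idealWidth = 0` for `d > m`. -/
theorem idealWidth_pos_iff (hm : 5 ≤ m) : 0 < idealWidth (biPermSubst m) (perPoly (Fin m) ℂ) d ↔ d ≤ m := by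
  refine ⟨fun h => ?_, fun h => ?_⟩
  · by_contra hlt
    exact h.ne' (idealWidth_eq_zero_of_lt (not_le.mp hlt))
  · have h1 := sq_div_gcd_le_idealWidth' (by omega) h
    have h2 : 0 < m / Nat.gcd m d :=
      Nat.div_pos (Nat.le_of_dvd (by omega) (Nat.gcd_dvd_left m d)) (Nat.gcd_pos_of_pos_left d (by omega))
    exact lt_of_lt_of_le (pow_pos h2 2) h1

end Summit.ValiantsHypothesis.ValiantsHypothesis.Theorems.EquivariantDialLayersNonempty
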